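import Summits.QuantumFields.BalabanUV.Beta.FP.CubicGermExchange
import Summits.QuantumFields.BalabanUV.Beta.ResolventPermutation
import Summits.QuantumFields.BalabanUV.Beta.LambdaPieceReflection
import Summits.QuantumFields.BalabanUV.Beta.BorderedHessianSymmetry
import Summits.QuantumFields.BalabanUV.Beta.AxialDressingRootedKernel

/-!
# `BalabanUV.Beta.FP.AdmissibleCubicGerm` — road «FP» for binder row D1, row **H2V-1** of the owner's `H2V-DESIGN.md` (b2b-balaban-beta-d1-p3 gen 6,
# ruling R-FP-23; `LEAVES-FP.md` row H2V-1): THE ADMISSIBLE LETTERS OF A CUBIC VERTEX FAMILY ⟹ ITS GERM IS `cQ·ymGerm` AND THE HESSIAN COLUMN'S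
# QUADRATIC GERM IS THE MAXWELL GERM `cQ(|k|²δ − kk)` — BY NAME; PLUS THE LEVEL-0 CHECK INSTANCE `V3 := wilsonA 3`

HONEST DEPENDENCY (page 1, mandatory): continuum YM on T⁴ ⇐ BetaPertH ∧ nine spine estimates (0/9 proved); BetaPertH ⇐ (D1) ∧ (D4) ∧ CAP+tail;
G-an2-4 gates asym, D1 and NE2/3/4.  HONEST FRAMING (cell contract, verbatim): «discharging `BetaPertH` makes Bałaban's UV stability UNCONDITIONAL —
a real constructive-QFT result; it is NOT the continuum limit and NOT the Clay problem.»  THIS MODULE DISCHARGES NOTHING of the wall: it is WIRING over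
`FP/CubicGermExchange.cubicGermOf_eq_ymGerm_of_bondLetters` (v1.1) + `FP/QuadGermUniqueness` + `FP/CubicGermWard` BY NAME, [folklore] lattice-form
algebra on the column of the level-0 Hessian block `d*d` (`BorderedHessian.bhK 1`: an2's `BalabanStepJets.elCol`, `SpineRooted.elCol_bref`,
`ResolventPermutation.curv_P1 ∕ curvAdj_P2 ∕ P1_delta1`, `BorderedHessian.curvAdj_curv_eq_window_sum ∕ curvAdj_curv_delta1_symm`), and ONE instance
check.  0 def, no cite, no `def … : Prop`, 0 sorry.  It proves NO letter for the perfect stencil `S_∞` (row H2V-4) and nothing of rows H2-ASM-1…5;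
NOT hgerm, NOT H2, NOT hasym, NOT D1, NOT BetaPertH, NOT continuum, NOT Clay.

ABSOLUTE RULE (cell charter, verbatim): «No internally-minted statement may enter as a cited fact. Every hypothesis is either kernel-proved in this package or a
verbatim quotation of a PUBLISHED theorem with page reference. The manuscript(s) under audit are NOT citable for their own disputed steps — they are the thing
under adjudication; programme-internal (2001/route/tribunal) claims are never citable.»

WHAT IS PROVED.
* §1 WIRING (`H2V-DESIGN.md` §2 ⟹ §2 CONSEQUENCE).  For a cubic vertex family `V3 : Fin 4 → ℤ⁴ → MKer 4 (Fib 3)` carrying the ADMISSIBLE LETTERS that the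
  germ uses — (a1) `LocStencil V3 Cs δ`, `0 < δ`; (a2) translation covariance `V3 λ v = shiftK (−v) (V3 λ 0)`; (a4) the divergence (tree Ward) law at the
  background site against a Hessian block `M` with constant `c`; (a5) `Decays M CM δM`, `0 < δM`, vanishing ZEROTH and FIRST column moments of `M`,
  axis-permutation covariance of the column and the BOND reflection law with an integer shift table `t`; (a6) Bose: the kernel's exchange defect has no first
  moments — **`cubicGermOf_eq_smul_ymGerm_of_admissible`**: `cubicGermOf V3 = cQ·ymGerm` AND `c·quadMomentOf M k = quadGerm cQ 0 0 k` for every momentum `k`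
  (the Hessian column's quadratic germ is TRANSVERSE and canonical — `α = γ = 0` of `QuadGermUniqueness` folded into one clause), `cQ = c·(−½ ∑'_x M x 0 (inl 0)
  (inl 0)·x₁²)`; **`cubicGermOf_eq_smul_ymGerm_of_admissible'`**: the same with the READ-OFF `cQ = c·quadMomentOf M e₁ 0 0` (the germ coefficient IS `c ×`
  the Hessian's transverse quadratic moment at unit momentum — the socket where H2V-4 ∕ H2-ASM-4 plug the `W166lim` normalisation to get `cQ = 1`);
  corollaries `wardGerm_of_admissible : WardGerm (cubicGermOf V3) (quadGerm cQ 0 0)`, the `∃ cQ` packaging `exists_cQ_of_admissible`, and — for row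
  H2-ASM-3, whose vertex is the TOTAL family `V3 + sliceV3` — `cubicGermOf_add` (the germ is additive over localised families) and
  `cubicGermOf_total_of_admissible : cubicGermOf (V3 + T) = cQ·ymGerm + cubicGermOf T` for any localised `T`.
  The design's letters (a3) (leg-wise zeroth moments of `V3`) and (a7) (reflection covariance of `V3` itself) are NOT used by the germ and are not dummy
  binders here — they remain letters of rows H2-ASM-1 ∕ H2-ASM-3 (the smear expansion and `hdK`).
* §2 [folklore] THE `d*d` COLUMN LETTERS (generic dimension `d + 1`).  For the column `x ↦ (d*d δ_{(ν,0)})_μ(x) = curvAdj (curv (delta1 ν 0)) μ x`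
  (`= bhK N x 0 (inl μ) (inl ν)`, `BorderedHessian.bhK_inl_inl_eq`): `tsum_ddCol_mul` (pairing against ANY weight `w` = `(d*d (w·dx_μ))_ν(0)`, a finite
  window sum), `tsum_ddCol_eq_zero` (zeroth moment: `d*d` annihilates constant 1-forms), `ddCol_perm` (axis-permutation covariance), `ddCol_bref` (the BOND
  reflection law `K(r_α x + ([ν=α] − [μ=α])e_α) = rs α μ · rs α ν · K x`, from an2's `elCol_bref` + translation + `bref_bref`), and at `d + 1 = 4` the one
  number `tsum_ddCol_x1sq : ∑'_x (d*d δ_{(0,0)})_0(x)·x₁² = −4` (direct evaluation of `d*d` on the quadratic 1-form `x₁²·dx_0` at the origin).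
* §3 THE CHECK INSTANCE `V3 := wilsonA 3` (an2's colour-stripped level-0 Wilson cubic table), `c = ½`, `M = bhK 1`: letters (h1) `StepJetData.locStencil_wilsonA`,
  (h2) `CubicGermWard.wilsonA_cov`, (h3) `CubicGermWard.wilsonA_law`, (h4) `BorderedHessian.decays_bhK`, (h5) §2 + `CubicGermWard.tsum_bhK_fst_moment_eq_zero`,
  (h7) §2 (`bhK_one_col_zeroth ∕ _perm ∕ _bref`), and (h6) via `CubicGermExchange.anti13_iff_defect` from `WilsonCubicGerm.symmetries_wilsonA` — HONEST: at
  level 0 the Bose letter is READ OFF the explicit germ `WilsonCubicGerm.cubicGermOf_wilsonA`, so the check exercises the Ward ∕ Hessian-column half of the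
  pipeline, not the Bose half — ⟹ **`cubicGermOf_wilsonA_of_letters`**: `cubicGermOf (wilsonA 3) = cQ_W·ymGerm ∧ ½·quadMomentOf (bhK 1) = quadGerm cQ_W 0 0`
  with `cQ_W = ½·quadMomentOf (bhK 1) e₁ 0 0`; **`half_quadMomentOf_bhK_unit : cQ_W = 1`** by the DIRECT window evaluation of §2 (independent of
  `cubicGermOf_wilsonA`; agrees with `CubicGermWard.half_quadMomentOf_bhK`); hence **`cubicGermOf_wilsonA_of_letters' : cubicGermOf (wilsonA 3) = ymGerm`** —
  `WilsonCubicGerm.cubicGermOf_wilsonA` RECOVERED through the letters (both routes give `ymGerm`).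
Provenance: G-an2-4 formalisation swarm seat b2b-balaban-gan24-formalise-leaf-01 gen 49 (cross-lane on road FP, row H2V-1 «→ any seat», R-FP-23 (c)), 2026-08-20.
-/

noncomputable section

namespace Summit.QuantumFields.BalabanUV.Beta.FP.AdmissibleCubicGerm

open Finset
open scoped BigOperators
open Literature.MathematicalPhysics.QuantumFieldTheory.Balaban1983to89
open Literature.MathematicalPhysics.QuantumFieldTheory.Balaban1983to89.Beta
open Literature.MathematicalPhysics.QuantumFieldTheory.Balaban1983to89.Beta.ExpKernelCalculus (Site MKer Decays shiftK)
open Literature.MathematicalPhysics.QuantumFieldTheory.Balaban1983to89.Beta.OneStepResolventKernel (Fib LocStencil)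
open Literature.MathematicalPhysics.QuantumFieldTheory.Balaban1983to89.Beta.KernelWard (divV)
open Literature.MathematicalPhysics.QuantumFieldTheory.Balaban1983to89.Beta.AffineAveraging (Form1 unitVec unitVec_apply curv curvAdj)
open Literature.MathematicalPhysics.QuantumFieldTheory.Balaban1983to89.Beta.KKTFluctuationKernel (delta1 delta1_apply)
open Literature.MathematicalPhysics.QuantumFieldTheory.Balaban1983to89.Beta.PolarizationSign (reflSign)
open Literature.MathematicalPhysics.QuantumFieldTheory.Balaban1983to89.Beta.ResolventReflection (bref bref_apply bref_bref)
open Literature.MathematicalPhysics.QuantumFieldTheory.Balaban1983to89.Beta.BalabanStepJets (elCol elCol_translate)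
open Literature.MathematicalPhysics.QuantumFieldTheory.Balaban1983to89.Beta.StepJetData (wilsonA wBound locStencil_wilsonA)
open Summit.QuantumFields.BalabanUV.Beta.KernelPermutation (psite psite_apply)
open Summit.QuantumFields.BalabanUV.Beta.ResolventPermutation (P1 P1_apply curv_P1 curvAdj_P2 P1_delta1)
open Summit.QuantumFields.BalabanUV.Beta.SpineRooted (elCol_bref bondDelta_eq_delta1)
open Summit.QuantumFields.BalabanUV.Beta.AxialDressingRooted (cube mem_cube tsum_window)
open Summit.QuantumFields.BalabanUV.Beta.BorderedHessian (bhK bhK_inl_inl_eq decays_bhK curvAdj_curv_eq_window_sum curvAdj_curv_delta1_eq_zero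
  curvAdj_curv_delta1_symm)
open Summit.QuantumFields.BalabanUV.Beta.FP.MarginalUniqueness (Idx δ ymGerm Anti13 rs)
open Summit.QuantumFields.BalabanUV.Beta.FP.WardNormalisation (WardGerm quadGerm nsq)
open Summit.QuantumFields.BalabanUV.Beta.FP.WilsonCubicGerm (cubicGermOf cubicGermOf_wilsonA symmetries_wilsonA)
open Summit.QuantumFields.BalabanUV.Beta.FP.CubicGermPairing (quadMomentOf)
open Summit.QuantumFields.BalabanUV.Beta.FP.CubicGermWard (wardGerm_cubicGermOf_of_law col_row_of_decays tsum_zeroth_eq_zero_of_col wilsonA_cov wilsonA_law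
  tsum_bhK_fst_moment_eq_zero)
open Summit.QuantumFields.BalabanUV.Beta.FP.QuadGermUniqueness (quadMomentOf_eq_quadGerm_bond)
open Summit.QuantumFields.BalabanUV.Beta.FP.CubicGermExchange (cubicGermOf_eq_ymGerm_of_bondLetters anti13_iff_defect)

/-! ## §1 Wiring: the admissible letters ⟹ `cubicGermOf V3 = cQ·ymGerm` and the Hessian column's quadratic germ is the Maxwell germ -/

section Admissible

/-- [folklore] the Maxwell germ at unit momentum `e₁`, polarisations `(0,0)`, reads off its coefficient: `quadGerm cQ 0 0 e₁ 0 0 = cQ`. -/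
theorem quadGerm_single_one (cQ : ℝ) : quadGerm cQ 0 0 (Pi.single (1 : Idx) (1 : ℝ)) 0 0 = cQ := by
  simp [quadGerm, nsq, MarginalUniqueness.δ, Pi.single_apply]

/-- [folklore] the leg-coordinate weight of `cubicGermOf` (row coordinate for `i = 0`, column coordinate for `i = 1`) is a degree-1 polynomial weight. -/
theorem abs_leg_le_weight (i : Fin 2) (κ : Fin 4) (x z : Site 4) :
    |(((if i = 0 then x κ else z κ : ℤ)) : ℝ)| ≤ 1 * ((B12Sec2to5.l1 x + 1) ^ 1 * (B12Sec2to5.l1 z + 1) ^ 1) := by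
  split_ifs
  · exact CubicGermPairing.abs_fst_le_weight κ x z
  · exact CubicGermPairing.abs_snd_le_weight κ x z

/-- [folklore] **THE CUBIC GERM IS ADDITIVE OVER LOCALISED FAMILIES**: `cubicGermOf (V + W) = cubicGermOf V + cubicGermOf W` entrywise (both pairings converge by
`CubicGermPairing.summable_pairOf`).  For row H2-ASM-3, whose vertex is the TOTAL family `V3 + sliceV3` of `H2V-DESIGN.md` §1. -/
theorem cubicGermOf_add {V W : Fin 4 → Site 4 → MKer 4 (Fib 3)} {Cv δv Cw δw : ℝ} (hV : LocStencil V Cv δv) (hδv : 0 < δv)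
    (hW : LocStencil W Cw δw) (hδw : 0 < δw) (μ ν lam κ : Fin 4) (i : Fin 2) :
    cubicGermOf (V + W) μ ν lam κ i = cubicGermOf V μ ν lam κ i + cubicGermOf W μ ν lam κ i := by
  have hv : Summable fun xz : Site 4 × Site 4 =>
      V lam 0 xz.1 xz.2 (Sum.inl μ) (Sum.inl ν) * (((if i = 0 then xz.1 κ else xz.2 κ : ℤ)) : ℝ) :=
    CubicGermPairing.summable_pairOf hV hδv (φ := fun x z => (((if i = 0 then x κ else z κ : ℤ)) : ℝ)) zero_le_one (abs_leg_le_weight i κ) lam μ ν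
  have hw : Summable fun xz : Site 4 × Site 4 =>
      W lam 0 xz.1 xz.2 (Sum.inl μ) (Sum.inl ν) * (((if i = 0 then xz.1 κ else xz.2 κ : ℤ)) : ℝ) :=
    CubicGermPairing.summable_pairOf hW hδw (φ := fun x z => (((if i = 0 then x κ else z κ : ℤ)) : ℝ)) zero_le_one (abs_leg_le_weight i κ) lam μ ν
  unfold cubicGermOf
  rw [← hv.tsum_add hw]
  refine tsum_congr fun xz => ?_
  simp only [Pi.add_apply]
  ring

/-! ### The admissible letters (`H2V-DESIGN.md` §2, the ones the germ uses) as section hypotheses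

(a1) `hS`, `hδ` — `LocStencil S Cs δ`, `0 < δ`; (a2) `hcov` — translation covariance; (a4) `hlaw` — the divergence (tree Ward) law at the background site
`divV S 0 x z (inl μ) (inl ν) = c·M x z (inl μ) (inl ν)·([z=0] − [x=0])` against the Hessian block `M` with constant `c`; (a5) `hM`, `hδM`, `hM0`, `hM1`, `hP`,
`t`, `hF` — `Decays M CM δM`, vanishing ZEROTH and FIRST column moments, axis-permutation covariance of the column, the BOND reflection law with integer
shift table `t`; (a6) `hD0`, `hD1` — the two first moments of the kernel's exchange defect `D_{λμν}(x,z) = S μ 0 x z (inl λ)(inl ν) + S λ x 0 z (inl μ)(inl ν)`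
vanish.  EXACTLY the hypothesis list of `CubicGermExchange.cubicGermOf_eq_ymGerm_of_bondLetters` (in its order).  The design's letters (a3) (leg-wise zeroth
moments of `V3`) and (a7) (reflection covariance of `V3` itself) are NOT used by the germ and are not hypotheses here. -/

variable {S : Fin 4 → Site 4 → MKer 4 (Fib 3)} {Cs δ c CM δM : ℝ} {M : MKer 4 (Fib 3)}
    (hS : LocStencil S Cs δ) (hδ : 0 < δ)
    (hcov : ∀ (lam : Fin 4) (v : Site 4), S lam v = shiftK (-v) (S lam 0))
    (hlaw : ∀ (x z : Site 4) (μ ν : Fin 4), divV S 0 x z (Sum.inl μ) (Sum.inl ν) =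
      c * M x z (Sum.inl μ) (Sum.inl ν) * ((if z = 0 then (1 : ℝ) else 0) - (if x = 0 then (1 : ℝ) else 0)))
    (hM : Decays M CM δM) (hδM : 0 < δM)
    (hM0 : ∀ (μ ν : Fin 4), ∑' x : Site 4, M x 0 (Sum.inl μ) (Sum.inl ν) = 0)
    (hM1 : ∀ (μ ν κ : Fin 4), ∑' x : Site 4, M x 0 (Sum.inl μ) (Sum.inl ν) * (x κ : ℝ) = 0)
    (hP : ∀ (σ : Equiv.Perm Idx) (x : Site 4) (μ ν : Fin 4),
      M (fun i => x (σ.symm i)) 0 (Sum.inl (σ μ)) (Sum.inl (σ ν)) = M x 0 (Sum.inl μ) (Sum.inl ν))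
    (t : Idx → Idx → Idx → ℤ)
    (hF : ∀ (α : Idx) (x : Site 4) (μ ν : Fin 4),
      M (fun i => if i = α then -x i + t α μ ν else x i) 0 (Sum.inl μ) (Sum.inl ν) = rs α μ * rs α ν * M x 0 (Sum.inl μ) (Sum.inl ν))
    (hD0 : ∀ μ ν lam κ : Fin 4,
      ∑' xz : Site 4 × Site 4, (S μ 0 xz.1 xz.2 (Sum.inl lam) (Sum.inl ν) + S lam xz.1 0 xz.2 (Sum.inl μ) (Sum.inl ν)) * (xz.1 κ : ℝ) = 0)
    (hD1 : ∀ μ ν lam κ : Fin 4,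
      ∑' xz : Site 4 × Site 4, (S μ 0 xz.1 xz.2 (Sum.inl lam) (Sum.inl ν) + S lam xz.1 0 xz.2 (Sum.inl μ) (Sum.inl ν)) * (xz.2 κ : ℝ) = 0)

include hS hδ hcov hlaw hM hδM hM0 hM1 hP hF hD0 hD1

/-- [our object] **ROW H2V-1 — THE ADMISSIBLE LETTERS FIX THE CUBIC GERM AND MAKE THE HESSIAN'S QUADRATIC GERM TRANSVERSE.**  Under the section hypotheses
(a1) (a2) (a4) (a5) (a6): with `cQ := c·(−½ ∑'_x M x 0 (inl 0) (inl 0)·x₁²)`, (i) `cubicGermOf S μ ν λ κ i = cQ · ymGerm μ ν λ κ i`, and (ii)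
`c · quadMomentOf M k μ ν = quadGerm cQ 0 0 k μ ν` for EVERY momentum `k` — the quadratic germ of the Hessian column, scaled by the Ward constant, IS the
canonical transverse germ `cQ(|k|²δ_{μν} − k_μk_ν)` (`CubicGermExchange.cubicGermOf_eq_ymGerm_of_bondLetters` + `QuadGermUniqueness.quadMomentOf_eq_quadGerm_bond`
BY NAME; their `α = γ = 0` folded into one clause). -/
theorem cubicGermOf_eq_smul_ymGerm_of_admissible :
    (∀ μ ν lam κ i, cubicGermOf S μ ν lam κ i =
        (c * (-(1 / 2 : ℝ) * ∑' x : Site 4, M x 0 (Sum.inl 0) (Sum.inl 0) * ((x 1 : ℝ) * (x 1 : ℝ)))) * ymGerm μ ν lam κ i) ∧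
      (∀ (k : Fin 4 → ℝ) (μ ν : Fin 4), c * quadMomentOf M k μ ν =
        quadGerm (c * (-(1 / 2 : ℝ) * ∑' x : Site 4, M x 0 (Sum.inl 0) (Sum.inl 0) * ((x 1 : ℝ) * (x 1 : ℝ)))) 0 0 k μ ν) := by
  obtain ⟨hG, hα, hγ⟩ := cubicGermOf_eq_ymGerm_of_bondLetters hS hδ hcov hlaw hM hδM hM0 hM1 hD0 hD1 hP t hF
  refine ⟨hG, fun k μ ν => ?_⟩
  rw [quadMomentOf_eq_quadGerm_bond (col_row_of_decays hM).1 hδM hM0 hM1 hP t hF k μ ν]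
  unfold quadGerm
  linear_combination (k μ * k ν) * hα + (MarginalUniqueness.δ μ ν * (k μ * k μ)) * hγ

/-- [our object] **THE SAME, WITH THE GERM COEFFICIENT READ OFF THE HESSIAN**: `cubicGermOf S = cQ · ymGerm` and `c · quadMomentOf M k = quadGerm cQ 0 0 k` with
**`cQ = c · quadMomentOf M e₁ 0 0`** — the cubic germ's coefficient IS the Ward constant times the Hessian column's transverse quadratic moment at unit momentum
`e₁ = Pi.single 1 1` in polarisations `(0,0)`.  (The socket of rows H2V-4 ∕ H2-ASM-4: for the perfect data, `c·quadMomentOf Δ_∞ e₁ 0 0` is the `p₁²`-coefficient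
of the `(0,0)` entry of the Maxwell symbol — `1` in the `W166lim` normalisation.) -/
theorem cubicGermOf_eq_smul_ymGerm_of_admissible' :
    (∀ μ ν lam κ i, cubicGermOf S μ ν lam κ i = (c * quadMomentOf M (Pi.single 1 1) 0 0) * ymGerm μ ν lam κ i) ∧
      (∀ (k : Fin 4 → ℝ) (μ ν : Fin 4), c * quadMomentOf M k μ ν = quadGerm (c * quadMomentOf M (Pi.single 1 1) 0 0) 0 0 k μ ν) := by
  obtain ⟨hG, hQ⟩ := cubicGermOf_eq_smul_ymGerm_of_admissible hS hδ hcov hlaw hM hδM hM0 hM1 hP t hF hD0 hD1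
  have e : c * quadMomentOf M (Pi.single 1 1) 0 0 =
      c * (-(1 / 2 : ℝ) * ∑' x : Site 4, M x 0 (Sum.inl 0) (Sum.inl 0) * ((x 1 : ℝ) * (x 1 : ℝ))) := by
    rw [hQ, quadGerm_single_one]
  rw [e]
  exact ⟨hG, hQ⟩

/-- [our object] COROLLARY — **THE GERM-LEVEL WARD IDENTITY AGAINST THE CANONICAL TRANSVERSE GERM**: `WardGerm (cubicGermOf S) (quadGerm cQ 0 0)` with
`cQ = c·quadMomentOf M e₁ 0 0` (`CubicGermWard.wardGerm_cubicGermOf_of_law`, its quadratic germ `c·quadMomentOf M` rewritten by clause (ii)). -/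
theorem wardGerm_of_admissible : WardGerm (cubicGermOf S) (quadGerm (c * quadMomentOf M (Pi.single 1 1) 0 0) 0 0) := by
  obtain ⟨-, hQ⟩ := cubicGermOf_eq_smul_ymGerm_of_admissible' hS hδ hcov hlaw hM hδM hM0 hM1 hP t hF hD0 hD1
  have hcr := col_row_of_decays (M := M) hM
  have hW := wardGerm_cubicGermOf_of_law hS hδ hcov hlaw hcr.1 hcr.2 hδM (tsum_zeroth_eq_zero_of_col hS hδ hcov hlaw hcr.1 hcr.2 hδM hM1)
  intro p q μ ν
  rw [← hQ q μ ν, ← hQ p μ ν]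
  exact hW p q μ ν

/-- [our object] COROLLARY — **THE `∃ cQ` PACKAGING** for consumers that only need «the germ is a multiple of `ymGerm` and the Hessian's quadratic germ is
transverse with the same coefficient». -/
theorem exists_cQ_of_admissible :
    ∃ cQ : ℝ, cubicGermOf S = (fun μ ν lam κ i => cQ * ymGerm μ ν lam κ i) ∧
      ∀ (k : Fin 4 → ℝ) (μ ν : Fin 4), c * quadMomentOf M k μ ν = quadGerm cQ 0 0 k μ ν := by
  obtain ⟨hG, hQ⟩ := cubicGermOf_eq_smul_ymGerm_of_admissible' hS hδ hcov hlaw hM hδM hM0 hM1 hP t hF hD0 hD1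
  exact ⟨_, funext fun μ => funext fun ν => funext fun lam => funext fun κ => funext fun i => hG μ ν lam κ i, hQ⟩

/-- [our object] COROLLARY — **THE GERM OF THE TOTAL FAMILY** (the vertex of `H2V-DESIGN.md` §1 is `V3 + sliceV3`): for admissible `S` and ANY localised second
family `T` (`LocStencil T Ct δt`, e.g. the slice stencil of row H2V-2), `cubicGermOf (S + T) = cQ·ymGerm + cubicGermOf T` entrywise, `cQ = c·quadMomentOf M e₁ 0 0`
— so with row H2V-2's `cubicGermOf sliceA = sliceGerm` and `cQ = 1` the total germ is an3's `bfGerm = ymGerm + sliceGerm` (row H2-ASM-4's input). -/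
theorem cubicGermOf_total_of_admissible {T : Fin 4 → Site 4 → MKer 4 (Fib 3)} {Ct δt : ℝ} (hT : LocStencil T Ct δt) (hδt : 0 < δt)
    (μ ν lam κ : Fin 4) (i : Fin 2) :
    cubicGermOf (S + T) μ ν lam κ i = (c * quadMomentOf M (Pi.single 1 1) 0 0) * ymGerm μ ν lam κ i + cubicGermOf T μ ν lam κ i := by
  rw [cubicGermOf_add hS hδ hT hδt, (cubicGermOf_eq_smul_ymGerm_of_admissible' hS hδ hcov hlaw hM hδM hM0 hM1 hP t hF hD0 hD1).1]

end Admissible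

/-! ## §2 The `d*d` column letters: pairing, zeroth moment, permutation covariance, bond reflection law, one second moment -/

section DdColumn

variable {d : ℕ}

/-- [folklore] **PAIRING THE `d*d` COLUMN AGAINST A WEIGHT IS `d*d` OF THE WEIGHTED COORDINATE 1-FORM AT THE ORIGIN**:
`∑'_x (d*d δ_{(ν,0)})_μ(x) · w(x) = (d*d (w·dx_μ))_ν(0)` — matrix symmetry of `d*d` (`curvAdj_curv_delta1_symm`), locality radius `2`
(`curvAdj_curv_delta1_eq_zero`, `tsum_window`) and linearity (`curvAdj_curv_eq_window_sum`); a finite window sum, no summability hypothesis. -/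
theorem tsum_ddCol_mul (μ ν : Fin (d + 1)) (w : (Fin (d + 1) → ℤ) → ℝ) :
    ∑' x : Fin (d + 1) → ℤ, curvAdj (curv (delta1 ν 0)) μ x * w x =
      curvAdj (curv (fun l y => if l = μ then w y else 0)) ν 0 := by
  have e : ∀ x : Fin (d + 1) → ℤ, curvAdj (curv (delta1 ν 0)) μ x * w x =
      if x - 0 ∈ cube (d + 1) 2 then curvAdj (curv (delta1 μ x)) ν 0 * w x else 0 := by
    intro x
    rw [curvAdj_curv_delta1_symm μ ν x 0]
    split_ifs with hx
    · rfl
    · rw [curvAdj_curv_delta1_eq_zero hx, zero_mul]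
  rw [tsum_congr e, tsum_window, curvAdj_curv_eq_window_sum]
  refine Finset.sum_congr rfl fun v _ => ?_
  rw [Finset.sum_eq_single μ]
  · rw [if_pos rfl]
  · intro l _ hl
    rw [if_neg hl, mul_zero]
  · intro h
    exact absurd (Finset.mem_univ μ) h

/-- [folklore] **THE `d*d` COLUMN HAS NO ZEROTH MOMENT** (`d*d` annihilates constant 1-forms: the curvature of a constant 1-form vanishes):
`∑'_x (d*d δ_{(ν,0)})_μ(x) = 0`. -/
theorem tsum_ddCol_eq_zero (μ ν : Fin (d + 1)) : ∑' x : Fin (d + 1) → ℤ, curvAdj (curv (delta1 ν 0)) μ x = 0 := by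
  have h := tsum_ddCol_mul μ ν fun _ => (1 : ℝ)
  simp only [mul_one] at h
  rw [h]
  have hc : curv (fun (l : Fin (d + 1)) (_ : Fin (d + 1) → ℤ) => if l = μ then (1 : ℝ) else 0) = 0 := by
    funext κ l y
    simp only [curv, Pi.zero_apply]
    ring
  rw [hc]
  simp [curvAdj]

/-- [folklore] **AXIS-PERMUTATION COVARIANCE OF THE `d*d` COLUMN**: `(d*d δ_{(σν,0)})_{σμ}(σ•x) = (d*d δ_{(ν,0)})_μ(x)`
(`ResolventPermutation.curv_P1 ∕ curvAdj_P2 ∕ P1_delta1`). -/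
theorem ddCol_perm (σ : Equiv.Perm (Fin (d + 1))) (μ ν : Fin (d + 1)) (x : Fin (d + 1) → ℤ) :
    curvAdj (curv (delta1 (σ ν) 0)) (σ μ) (psite σ x) = curvAdj (curv (delta1 ν 0)) μ x := by
  have h1 : P1 σ (delta1 (σ ν) (0 : Fin (d + 1) → ℤ)) = delta1 ν 0 := by
    have h := P1_delta1 σ ν (0 : Fin (d + 1) → ℤ)
    rwa [show psite σ (0 : Fin (d + 1) → ℤ) = 0 from rfl] at h
  have h2 := congrFun (congrFun (curvAdj_P2 σ (curv (delta1 (σ ν) (0 : Fin (d + 1) → ℤ)))) μ) x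
  rw [← curv_P1, h1, P1_apply] at h2
  exact h2.symm

/-- [folklore] `MarginalUniqueness.rs` IS `PolarizationSign.reflSign` (both `[μ = α] ↦ −1`). -/
theorem rs_eq_reflSign (α μ : Fin 4) : rs α μ = reflSign α μ := rfl

/-- [folklore] **THE BOND REFLECTION LAW OF THE `d*d` COLUMN** (letter (h7)-bond for the level-0 Hessian, shift table `t_{αμν} = [ν=α] − [μ=α]`):
`(d*d δ_{(ν,0)})_μ(r_α x + ([ν=α] − [μ=α])·e_α) = ε_α(μ)·ε_α(ν)·(d*d δ_{(ν,0)})_μ(x)`, `r_α` the sign flip of coordinate `α` — an2's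
`SpineRooted.elCol_bref` at the bond `(ν, 0)` read at the site `bref α μ x`, translation covariance `BalabanStepJets.elCol_translate`, and `bref_bref`. -/
theorem ddCol_bref (α μ ν : Fin (d + 1)) (x : Fin (d + 1) → ℤ) :
    curvAdj (curv (delta1 ν 0)) μ
        (fun i => if i = α then -x i + ((if ν = α then (1 : ℤ) else 0) - (if μ = α then (1 : ℤ) else 0)) else x i) =
      reflSign α μ * reflSign α ν * curvAdj (curv (delta1 ν 0)) μ x := by
  have h := elCol_bref α ν 0 μ (bref α μ x)
  rw [bref_bref] at h
  have ht : elCol ν (bref α ν 0) μ (bref α μ x) = elCol ν 0 μ (bref α μ x - bref α ν 0) := by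
    have e := elCol_translate ν 0 (bref α ν 0) μ (bref α μ x - bref α ν 0)
    rw [zero_add, sub_add_cancel] at e
    exact e
  have hv : bref α μ x - bref α ν 0 =
      fun i => if i = α then -x i + ((if ν = α then (1 : ℤ) else 0) - (if μ = α then (1 : ℤ) else 0)) else x i := by
    funext i
    rw [Pi.sub_apply, bref_apply, bref_apply]
    by_cases hi : i = α
    · simp only [hi, if_true, Pi.zero_apply]
      ring
    · simp only [hi, if_false, Pi.zero_apply, sub_zero]
  rw [ht, hv] at h
  unfold BalabanStepJets.elCol at h
  rw [bondDelta_eq_delta1] at h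
  rw [h]
  ring

/-- [folklore] **ONE SECOND MOMENT OF THE `d*d` COLUMN ON `ℤ⁴`**: `∑'_x (d*d δ_{(0,0)})_0(x)·x₁² = −4` — by `tsum_ddCol_mul`, `d*d` of the quadratic 1-form
`x₁²·dx_0` at the origin (curl: `(x₁+1)² − x₁²` on the `(1,0)`-plaquettes, adjoint: `(−1) − (1)` twice).  The number that normalises the level-0 check. -/
theorem tsum_ddCol_x1sq :
    ∑' x : Fin 4 → ℤ, curvAdj (curv (delta1 (0 : Fin 4) 0)) 0 x * ((x 1 : ℝ) * (x 1 : ℝ)) = -4 := by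
  rw [tsum_ddCol_mul (d := 3) 0 0 fun x => (x 1 : ℝ) * (x 1 : ℝ)]
  simp [curvAdj, curv, Fin.sum_univ_four, unitVec_apply]
  norm_num

end DdColumn

/-! ## §3 The check instance: an2's level-0 Wilson table `wilsonA 3` through the letters -/

section Wilson

/-- [folklore] (h5)-zeroth for the level-0 Hessian block: `∑'_x bhK 1 x 0 (inl μ) (inl ν) = 0` (`bhK_inl_inl_eq` + `tsum_ddCol_eq_zero`). -/
theorem bhK_one_col_zeroth (μ ν : Fin 4) : ∑' x : Site 4, bhK (d := 3) 1 x 0 (Sum.inl μ) (Sum.inl ν) = 0 := by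
  simp only [bhK_inl_inl_eq]
  exact tsum_ddCol_eq_zero (d := 3) μ ν

/-- [folklore] (h7)-permutation for the level-0 Hessian block: `bhK 1 (x ∘ σ⁻¹) 0 (inl σμ) (inl σν) = bhK 1 x 0 (inl μ) (inl ν)`. -/
theorem bhK_one_col_perm (σ : Equiv.Perm Idx) (x : Site 4) (μ ν : Fin 4) :
    bhK (d := 3) 1 (fun i => x (σ.symm i)) 0 (Sum.inl (σ μ)) (Sum.inl (σ ν)) = bhK (d := 3) 1 x 0 (Sum.inl μ) (Sum.inl ν) := by
  rw [bhK_inl_inl_eq, bhK_inl_inl_eq]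
  exact ddCol_perm (d := 3) σ μ ν x

/-- [folklore] (h7)-bond for the level-0 Hessian block, shift table `t_{αμν} = [ν=α] − [μ=α]`:
`bhK 1 (r_α x + t_{αμν} e_α) 0 (inl μ) (inl ν) = rs α μ · rs α ν · bhK 1 x 0 (inl μ) (inl ν)`. -/
theorem bhK_one_col_bref (α : Idx) (x : Site 4) (μ ν : Fin 4) :
    bhK (d := 3) 1 (fun i => if i = α then -x i + ((if ν = α then (1 : ℤ) else 0) - (if μ = α then (1 : ℤ) else 0)) else x i) 0
        (Sum.inl μ) (Sum.inl ν) =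
      rs α μ * rs α ν * bhK (d := 3) 1 x 0 (Sum.inl μ) (Sum.inl ν) := by
  rw [bhK_inl_inl_eq, bhK_inl_inl_eq, rs_eq_reflSign, rs_eq_reflSign]
  exact ddCol_bref (d := 3) α μ ν x

/-- [our object] **THE LEVEL-0 CHECK — THE WILSON TABLE THROUGH THE LETTERS**: `V3 := wilsonA 3`, `c = ½`, `M = bhK 1` satisfy every hypothesis of
`cubicGermOf_eq_smul_ymGerm_of_admissible'` — (h1) `locStencil_wilsonA`, (h2) `wilsonA_cov`, (h3) `wilsonA_law`, (h4) `decays_bhK`, (h5)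
`bhK_one_col_zeroth` + `tsum_bhK_fst_moment_eq_zero`, (h7) `bhK_one_col_perm` + `bhK_one_col_bref`, and (h6) via `anti13_iff_defect` from
`WilsonCubicGerm.symmetries_wilsonA` (HONEST: the Bose letter at level 0 is READ OFF the explicit germ `cubicGermOf_wilsonA`; what is exercised independently
is the Ward ∕ Hessian-column half of the pipeline) — hence `cubicGermOf (wilsonA 3) = cQ_W · ymGerm` and `½·quadMomentOf (bhK 1) k = quadGerm cQ_W 0 0 k` with
`cQ_W = ½·quadMomentOf (bhK 1) e₁ 0 0`. -/
theorem cubicGermOf_wilsonA_of_letters :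
    (∀ μ ν lam κ i, cubicGermOf (wilsonA 3) μ ν lam κ i =
        ((1 / 2 : ℝ) * quadMomentOf (bhK (d := 3) 1) (Pi.single 1 1) 0 0) * ymGerm μ ν lam κ i) ∧
      (∀ (k : Fin 4 → ℝ) (μ ν : Fin 4), (1 / 2 : ℝ) * quadMomentOf (bhK (d := 3) 1) k μ ν =
        quadGerm ((1 / 2 : ℝ) * quadMomentOf (bhK (d := 3) 1) (Pi.single 1 1) 0 0) 0 0 k μ ν) := by
  have hS : LocStencil (wilsonA 3) (wBound 3 * Real.exp (4 * 1)) 1 := locStencil_wilsonA (d := 3) zero_le_one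
  have hD := (anti13_iff_defect hS one_pos wilsonA_cov).1 symmetries_wilsonA.2.1
  exact cubicGermOf_eq_smul_ymGerm_of_admissible' hS one_pos wilsonA_cov wilsonA_law (decays_bhK (d := 3) (N := 1) le_rfl zero_le_one) one_pos
    bhK_one_col_zeroth (fun μ ν κ => tsum_bhK_fst_moment_eq_zero κ μ ν) bhK_one_col_perm
    (fun α μ ν => (if ν = α then (1 : ℤ) else 0) - (if μ = α then (1 : ℤ) else 0)) bhK_one_col_bref hD.1 hD.2

/-- [our object] **THE LEVEL-0 NORMALISATION, COMPUTED FROM THE HESSIAN COLUMN ALONE**: `½ · quadMomentOf (bhK 1) e₁ 0 0 = 1` — the direct window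
evaluation `tsum_ddCol_x1sq` (`∑'_x (d*d δ_{(0,0)})_0(x)·x₁² = −4`), independent of `WilsonCubicGerm.cubicGermOf_wilsonA`; it agrees with
`CubicGermWard.half_quadMomentOf_bhK` (which the tree derived from the explicit germ). -/
theorem half_quadMomentOf_bhK_unit : (1 / 2 : ℝ) * quadMomentOf (bhK (d := 3) 1) (Pi.single 1 1) 0 0 = 1 := by
  unfold quadMomentOf
  have e : ∀ x : Site 4, bhK (d := 3) 1 x 0 (Sum.inl 0) (Sum.inl 0) * (∑ κ : Fin 4, (Pi.single 1 1 : Fin 4 → ℝ) κ * (x κ : ℝ)) ^ 2 =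
      curvAdj (curv (delta1 (0 : Fin 4) 0)) 0 x * ((x 1 : ℝ) * (x 1 : ℝ)) := by
    intro x
    rw [bhK_inl_inl_eq]
    simp [Pi.single_apply, sq]
  rw [tsum_congr e, tsum_ddCol_x1sq]
  norm_num

/-- [our object] **`cubicGermOf_wilsonA` RECOVERED THROUGH THE LETTERS** (the row's CHECK: both routes give `ymGerm`): from `cubicGermOf_wilsonA_of_letters`
and the column normalisation `half_quadMomentOf_bhK_unit`, `cubicGermOf (wilsonA 3) = ymGerm` — the statement of `WilsonCubicGerm.cubicGermOf_wilsonA`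
(whose germ-level `Anti13` fed letter (h6); see the honesty clause of `cubicGermOf_wilsonA_of_letters`). -/
theorem cubicGermOf_wilsonA_of_letters' : cubicGermOf (wilsonA 3) = ymGerm := by
  funext μ ν lam κ i
  rw [cubicGermOf_wilsonA_of_letters.1 μ ν lam κ i, half_quadMomentOf_bhK_unit, one_mul]

end Wilson

end Summit.QuantumFields.BalabanUV.Beta.FP.AdmissibleCubicGerm
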